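import Summits.BirchSwinnertonDyer.Rank1Residual.P2.CongruentNumberPairsAtTwoRankOne
import Summits.BirchSwinnertonDyer.Rank1Residual.P2.CongruentNumberPairsAtTwoTable
import Literature.NumberTheory.EllipticCurves.TianYuanZhang2017.ScriptLOddOfRhoZero
import Literature.NumberTheory.EllipticCurves.TianYuanZhang2017.GenusFieldFamily
import HarnessLib

/-!
# Sub-lane «bsd-p2»: DOOR D-CN-6 — rank-one congruent-number pairs `(E_n, 2)` whose `L′`-datum is a
# THEOREM: Tian–Yuan–Zhang's genus periods at `ρ(n) = 0` (p2-lead QUEUE v3 (ii), T-48 / L1-29 / L1-30;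
# design note p2/LIT-STATUS.md T1-M19)

HONEST FRAMING (sub-lane «bsd-p2», run/shared/lean/b2b/bsd-rank1-residual/p2/, verbatim in every
file): the target of record is the FULL Birch–Swinnerton-Dyer formula for EVERY analytic-rank `≤ 1`
`E/ℚ` at ALL primes INCLUDING `2`; the odd-prime class ledger is referee A's; the `2`-part is OPEN
(cells O1 = X5 ∖ CM and O12 = the CM corner) and under census by «bsd-p2». Census / instrument
output at `2` = EVIDENCE / conjecture items with held-out validation, NEVER a Literature fact;
certificates close PAIRS (one isogeny class, `p = 2`), never classes. This file asserts NO
arithmetic fact. WHAT IT DOES. Door D-CN-5 (`P2/CongruentNumberPairsAtTwoRankOne.lean`, p320819)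
closes a rank-one pair `(E_n, 2)` from the EXACT datum `x = L′(E_n,1)/(Ω·Reg)`, which the pilot
(p321997) had to DISPLAY as census evidence. Door D-CN-6 DISCHARGES that datum by a THEOREM: for
square-free `n ≡ 5, 7 (mod 8)` with `ρ(n) = 0` and an odd genus sum, Tian–Yuan–Zhang 2017 Thm 1.2
(named fact `h12`, AS PRINTED by p2-lit-1, p310142) gives `ord_{s=1} L(E_n,s) = 1` and
`L′(E_n,1) = 2^{2k(n)−3}·𝓛²·Ω(E_n)·Reg(E_n)` with `𝓛` ODD (`rankOneDatum_of_index_eq_one`, p322630),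
so `ord₂ x = 2k − 3` with NO L-value computed. The remaining inputs and their tier:
* `ρ(n) = 0` as `(rhoSubgroup n).index = 1` — a HYPOTHESIS `hρ` of the door; per instance it is
  p2-monsky-lit's φ̂-descent THEOREM (§R, `FaulknerJames2007/RhoIndexEvenPartitionBound.lean`,
  Faulkner–James' even-partition Laplacian kernel counted by `decide`) — not restated here;
* the genus condition `Σ₁` odd or `Σ₂` odd for the CONCRETE family `K_d = GenusField d` (p323102) —
  a HYPOTHESIS `hgen` of the door in that form; the sibling `P2/CongruentNumberPairsAtTwoGenusRedei.lean`
  makes it KERNEL-DECIDABLE per `n` modulo the displayed Rédei–Reichardt fact (one `decide`);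
* `s(n) = 1` (`#Sel₂(E_n) = 8`): Monsky's matrix (named fact `hM`, Monsky 1994) by the TABLE ROUTE of
  `P2/CongruentNumberPairsAtTwoTable.lean` with a COUNTED kernel (`#ker = 2`, `decide`) — §1; with
  `ord = 1`, Gross–Zagier–Kolyvagin (`hGZK`) gives rank `1` and then `Ш(E_n)[2^∞] = 0`
  (`#Sel₂ = 2^{rank}·#E[2]·#Ш[2]`, §1);
* DISPLAYED per instance (EVIDENCE, GAP G-T1 / L2-15): `#E_n(ℚ)_tor = 4` (`ht`) and the Tamagawa
  product `∏c_ℓ(E_n) = 2^{2k+1}` (`htam`).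
CONCLUSION (§2): `BSD(E_n, 2)`; and, without `htam`, the biconditional
`BSD(E_n, 2) ⟺ ord₂ ∏c_ℓ(E_n) = 2k + 1` — the Tamagawa valuation is the ONLY input left displayed.
Per-pair statements in the OPEN cell `openO12`; they close no class. Nothing booked; no mark moved.
Unit `b2b-bsdres-p2-typer` GEN 4; NEW file. Instances (eng's 11 PilotRho rows) follow in a sibling file
once §R is in the tree. RE-KEY (append §3, ruling T-81/T-84): the GEN-1 fact `thm12_parity_of_scriptL`
is MIS-STATED (Σ₂ without its `ℓ = 0` term); `bsdp_two_congruentNumberCurve_iff_of_genus'` is the door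
keyed to the printed theorem `thm12_parity_of_scriptL'` (genus hypothesis `Σ₁` odd or `Σ₂'` odd).

References: [TianYuanZhang2017] Thm 1.2, §1; [SilvermanAEC2009] Thm X.4.2;
[HeathBrown1994SelmerCongruentII] Appendix (Monsky); [Monsky1990MockHeegner] Cor 5.15;
[Miller2011LMS] Def 1.1; HOME/p2/LIT-STATUS.md T1-M19, T1-M21; HOME/p2/LEAD-OKS.md T-48, L1-29, L1-30.
-/

noncomputable section

open scoped Classical

open Matrix Finset WeierstrassCurve NumberField Literature.NumberTheory.EllipticCurves
  Literature.NumberTheory.EllipticCurves.Rank1Residual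
  Literature.NumberTheory.EllipticCurves.Rank1Residual.Typed
  Literature.NumberTheory.EllipticCurves.Monsky1990
  Literature.NumberTheory.EllipticCurves.HeathBrown1994
  Literature.NumberTheory.EllipticCurves.TianYuanZhang2017
  Literature.NumberTheory.QuadraticFields.RedeiReichardt

set_option autoImplicit false

namespace Summit.BirchSwinnertonDyer.Rank1Residual.P2

/-! ## §1 The Selmer side: `s(n) = s` by the TABLE ROUTE with a counted kernel; `Ш[2^∞] = 0` -/

section SelmerSide

variable {k : ℕ} (p : Fin k → ℕ)

/-- Rank–nullity over `𝔽₂` on the index type `Fin k ⊕ Fin k`: `#{v : M v = 0} = 2^{2k − rank M}`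
(p2-monsky-eng's `card_ker_mulVec_eq_sum`). [cite: HeathBrown1994SelmerCongruentII, Appendix (Monsky), typescript p. 39 L1–L9 and L33] -/
theorem card_ker_mulVec_eq_sum (M : Matrix (Fin k ⊕ Fin k) (Fin k ⊕ Fin k) (ZMod 2)) :
    Fintype.card {v : Fin k ⊕ Fin k → ZMod 2 // M *ᵥ v = 0} = 2 ^ (2 * k - M.rank) := by
  have hrn := LinearMap.finrank_range_add_finrank_ker M.mulVecLin
  rw [Module.finrank_pi (ZMod 2), Fintype.card_sum, Fintype.card_fin] at hrn
  have hker : Module.finrank (ZMod 2) (LinearMap.ker M.mulVecLin) = 2 * k - M.rank := by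
    rw [Matrix.rank]
    omega
  have hcard : Nat.card (LinearMap.ker M.mulVecLin) = 2 ^ (2 * k - M.rank) := by
    rw [Module.natCard_eq_pow_finrank (K := ZMod 2), Nat.card_zmod, hker]
  rw [← hcard, ← Nat.card_eq_fintype_card]
  exact Nat.card_congr (Equiv.subtypeEquivRight (q := fun v => v ∈ LinearMap.ker M.mulVecLin)
    fun v => by rw [LinearMap.mem_ker, Matrix.mulVecLin_apply])

/-- **TABLE ROUTE FOR THE SELMER RANK (odd `n`)**: certified symbol tables `L`, `d2 = [(2/pᵢ) ≠ 1]`,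
`dm2 = [(−2/pᵢ) ≠ 1]` and a COUNTED kernel of the table matrix (`#ker = 2^s`, by `decide`) give
`s(n) = 2k − rank M = s` (p2-monsky-eng's `monskySelmerRankOdd_eq_of_table`, with the table matrix
inlined as in `det_monskyMatrixOdd_of_table`). [cite: HeathBrown1994SelmerCongruentII, Appendix (Monsky), typescript p. 39 L27–L33] -/
theorem monskySelmerRankOdd_eq_of_table (L : Fin k → Fin k → ZMod 2) (d2 dm2 : Fin k → ZMod 2)
    (hL : ∀ i j, addLegendreSym (p j) (p i) = L i j) (h2 : ∀ i, addLegendreSym 2 (p i) = d2 i)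
    (hm2 : ∀ i, addLegendreSym (-2) (p i) = dm2 i) {s : ℕ}
    (hcard : Fintype.card {v : Fin k ⊕ Fin k → ZMod 2 // Matrix.fromBlocks
        (Matrix.of (fun i j => if i = j then ∑ l ∈ Finset.univ.erase i, L i l else L i j) +
          Matrix.diagonal d2) (Matrix.diagonal d2) (Matrix.diagonal d2)
        (Matrix.of (fun i j => if i = j then ∑ l ∈ Finset.univ.erase i, L i l else L i j) +
          Matrix.diagonal dm2) *ᵥ v = 0} = 2 ^ s) :
    monskySelmerRankOdd p = s := by
  have e : monskyMatrixOdd p = Matrix.fromBlocks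
      (Matrix.of (fun i j => if i = j then ∑ l ∈ Finset.univ.erase i, L i l else L i j) +
        Matrix.diagonal d2) (Matrix.diagonal d2) (Matrix.diagonal d2)
      (Matrix.of (fun i j => if i = j then ∑ l ∈ Finset.univ.erase i, L i l else L i j) +
        Matrix.diagonal dm2) := by
    simp only [monskyMatrixOdd, legendreMatrix_eq_ofTable p L hL,
      legendreDiagonal_eq_ofTable p 2 d2 h2, legendreDiagonal_eq_ofTable p (-2) dm2 hm2]
  have h := card_ker_mulVec_eq_sum (monskyMatrixOdd p)
  rw [e, hcard] at h
  have hs : s = 2 * k - (monskyMatrixOdd p).rank := by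
    rw [e]; exact Nat.pow_right_injective le_rfl h
  rw [monskySelmerRankOdd]
  exact hs.symm

/-- **`#Sel₂(E_N) = 8`, rank `1` ⟹ `Ш(E_N)[2^∞] = 0`** for `E_N : y² = x³ − N²x`: the descent count
`#Sel₂ = 2^{rank}·#E(ℚ)[2]·#(Ш ⊓ H¹[2])` (Silverman X.4.2) with `#E_N(ℚ)[2] = 4` leaves `#Ш[2] = 1`.
(The argument of `Monsky1990.primaryComponent_sha_two_eq_bot_of_cor515`, with the rank as a
hypothesis instead of Cor 5.15.) [cite: SilvermanAEC2009, Thm. X.4.2] -/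
theorem primaryComponent_sha_two_eq_bot_of_card_selmerGroup_eq_eight {N : ℕ} (hN : N ≠ 0)
    (hrank : haveI := isElliptic_congruentNumberCurve hN; (congruentNumberCurve N).mordellWeilRank = 1)
    (hsel : haveI := isElliptic_congruentNumberCurve hN;
      Nat.card ((congruentNumberCurve N).selmerGroup 2) = 8) :
    haveI := isElliptic_congruentNumberCurve hN
    AddCommGroup.primaryComponent (congruentNumberCurve N).sha 2 = ⊥ := by
  haveI := isElliptic_congruentNumberCurve hN
  haveI : Fact (Nat.Prime 2) := ⟨Nat.prime_two⟩
  have hsel' : Nat.card ((congruentNumberCurve N).selmerGroup ((2 : ℕ) : ℤ)) = 8 := by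
    simpa only [Nat.cast_ofNat] using hsel
  have hcard := (congruentNumberCurve N).natCard_selmerGroup_eq (n := 2) two_ne_zero
  rw [hsel', hrank, pow_one] at hcard
  have aux : ∀ {T S : ℕ}, 8 = 2 * T * S → T = 4 → S = 1 := by
    intro T S hTS hT
    subst hT
    omega
  have hone := aux hcard
    (by convert Smith2016.natCard_torsionBy_two_congruentNumberCurve hN; norm_num)
  exact primaryComponent_sha_eq_bot_of_inf_torsionBy_eq_bot (congruentNumberCurve N) 2
    (AddSubgroup.eq_bot_of_card_eq _ hone)

end SelmerSide

/-! ## §2 The door -/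

section Door

/-- `ord₂(2^e · L²) = e` for an odd integer `L` (`e ∈ ℤ`). [folklore] -/
theorem padicValRat_two_zpow_mul_sq {L : ℤ} (hL : Odd L) (e : ℤ) :
    padicValRat 2 ((2 : ℚ) ^ e * (L : ℚ) ^ 2) = e := by
  haveI : Fact (Nat.Prime 2) := ⟨Nat.prime_two⟩
  have hL0' : L ≠ 0 := fun h => by simp [h] at hL
  have hL0 : (L : ℚ) ≠ 0 := by exact_mod_cast hL0'
  have hv : padicValRat 2 (L : ℚ) = 0 := by
    rw [padicValRat.of_int, padicValInt.eq_zero_of_not_dvd]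
    · simp
    · exact fun h2 => (Int.not_even_iff_odd.mpr hL) (even_iff_two_dvd.mpr (by exact_mod_cast h2))
  have h2 : padicValRat 2 (2 : ℚ) = 1 := by
    rw [show (2 : ℚ) = ((2 : ℕ) : ℚ) by norm_num, padicValRat.of_nat]
    simp
  rw [padicValRat.mul (zpow_ne_zero _ two_ne_zero) (pow_ne_zero _ hL0), padicValRat.zpow,
    padicValRat.pow, hv, h2]
  ring

variable {k : ℕ} (p : Fin k → ℕ)

/-- `k(n) = k` and `a(n) = 1` for `n = p₁⋯p_k` with distinct ODD primes: `2k(n) − 2 − a(n) = 2k − 3`.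
[cite: TianYuanZhang2017, §1 (p0002 L63–L65: k(n), a(n))] -/
theorem twoExponent_prod_eq (hp : ∀ i, (p i).Prime) (hodd : ∀ i, Odd (p i))
    (hinj : Function.Injective p) : twoExponent (∏ i, p i) = 2 * (k : ℤ) - 3 := by
  have hprod : ∏ i, p i = ∏ q ∈ univ.image p, q := by
    rw [Finset.prod_image fun i _ j _ h => hinj h]
  have hpf : (∏ i, p i).primeFactors = univ.image p := by
    rw [hprod, Nat.primeFactors_prod]
    simpa using fun i => hp i
  have hk : oddPrimeFactorCount (∏ i, p i) = k := by
    rw [oddPrimeFactorCount, hpf, Finset.filter_true_of_mem (by simpa using fun i => hodd i),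
      Finset.card_image_of_injective _ hinj, Finset.card_univ, Fintype.card_fin]
  have ha : oddIndicator (∏ i, p i) = 1 := by
    rw [oddIndicator, if_neg (Nat.not_even_iff_odd.mpr
      (Finset.prod_induction _ Odd (fun a b ha hb => ha.mul hb) odd_one fun i _ => hodd i))]
  rw [twoExponent, hk, ha]
  push_cast
  ring

/-- **DOOR D-CN-6 — the biconditional.** `n = p₁⋯p_k` (distinct odd primes), `n ≡ 5, 7 (mod 8)`;
named facts as binders: `h12` (Tian–Yuan–Zhang 2017 Thm 1.2), `hGZK`
(Gross–Zagier–Kolyvagin), `hM` (Monsky 1994, odd case); KERNEL-DECIDED inputs: `s(n) = 1` by the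
table route with a counted kernel (`hker`), the genus condition `Σ₁` odd or `Σ₂` odd
for `K_d = GenusField d` (`hgen`; per instance ONE `decide` through
`odd_genusSum_genusField_iff` of `P2/CongruentNumberPairsAtTwoGenusRedei.lean`); HYPOTHESIS `hρ : ρ(n) = 0` (per instance: monsky-lit's
φ̂-descent theorem); DISPLAYED: `#E_n(ℚ)_tor = 4` (`ht`). THEN `ord_{s=1} L(E_n,s) = 1`, rank
`E_n(ℚ) = 1`, `Ш(E_n)[2^∞] = 0`, and `BSD(E_n, 2) ⟺ ord₂ ∏c_ℓ(E_n) = 2k + 1` — the Tamagawa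
valuation (GAP G-T1) is the only input left. No L-value is computed: `L′(E_n,1)/(Ω·Reg) =
2^{2k−3}·𝓛²` with `𝓛` odd by TYZ. [cite: TianYuanZhang2017, Thm. 1.2 and §1 (1.1)]
[cite: HeathBrown1994SelmerCongruentII, Appendix (Monsky), typescript p. 39 L10–L33]
[cite: LiMa2008, Thm. 0.4] [cite: Miller2011LMS, Def. 1.1 (arXiv:1010.2431 p. 3)] -/
theorem bsdp_two_congruentNumberCurve_iff_of_genus (h12 : thm12_parity_of_scriptL)
    (hGZK : rank_eq_analyticRank_of_analyticRank_le_one) (hM : monsky_card_selmerGroup_two_odd)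
    (hp : ∀ i, (p i).Prime) (hodd : ∀ i, Odd (p i)) (hinj : Function.Injective p)
    {n : ℕ} (hn : ∏ i, p i = n) (h8 : n % 8 = 5 ∨ n % 8 = 7)
    (L : Fin k → Fin k → ZMod 2) (d2 dm2 : Fin k → ZMod 2)
    (hL : ∀ i j, addLegendreSym (p j) (p i) = L i j) (h2 : ∀ i, addLegendreSym 2 (p i) = d2 i)
    (hm2 : ∀ i, addLegendreSym (-2) (p i) = dm2 i)
    (hker : Fintype.card {v : Fin k ⊕ Fin k → ZMod 2 // Matrix.fromBlocks
        (Matrix.of (fun i j => if i = j then ∑ l ∈ Finset.univ.erase i, L i l else L i j) +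
          Matrix.diagonal d2) (Matrix.diagonal d2) (Matrix.diagonal d2)
        (Matrix.of (fun i j => if i = j then ∑ l ∈ Finset.univ.erase i, L i l else L i j) +
          Matrix.diagonal dm2) *ᵥ v = 0} = 2)
    (hρ : (rhoSubgroup n).index = 1)
    (hgen : Odd (genusSum₁ n fun d => genusClassNumber (GenusField d)) ∨
      Odd (genusSum₂ n fun d => genusClassNumber (GenusField d)))
    (ht : haveI := isElliptic_congruentNumberCurve (hn ▸ (squarefree_prod_of_injective p hp hinj).ne_zero);
      (congruentNumberCurve n).torsionOrder = 4) :
    haveI := isElliptic_congruentNumberCurve (hn ▸ (squarefree_prod_of_injective p hp hinj).ne_zero)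
    (congruentNumberCurve n).analyticRank = 1 ∧ (congruentNumberCurve n).mordellWeilRank = 1 ∧
      AddCommGroup.primaryComponent (congruentNumberCurve n).sha 2 = ⊥ ∧
      (BSDp (congruentNumberCurve n) 2 ↔
        padicValNat 2 (congruentNumberCurve n).tamagawaProduct = 2 * k + 1) := by
  have hsq : Squarefree n := hn ▸ squarefree_prod_of_injective p hp hinj
  have hn0 : n ≠ 0 := hsq.ne_zero
  haveI := isElliptic_congruentNumberCurve hn0
  haveI : Fact (Nat.Prime 2) := ⟨Nat.prime_two⟩
  -- TYZ: `ord = 1`, `L′ = 2^e · 𝓛² · Ω · Reg` with `𝓛` odd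
  obtain ⟨Lz, hLodd, hr1, hderiv⟩ :=
    rankOneDatum_of_index_eq_one h12 hsq h8 hρ GenusField (isGenusFieldFamily_genusField n) hgen
  have hx : deriv (congruentNumberCurve n).entireLFunction 1 =
      (((2 : ℚ) ^ twoExponent n * (Lz : ℚ) ^ 2 : ℚ) : ℂ) *
        ((congruentNumberCurve n).realPeriodRat : ℂ) * ((congruentNumberCurve n).regulator : ℂ) := by
    rw [hderiv]; push_cast; ring
  -- GZK: rank `1`; Monsky + counted kernel: `#Sel₂ = 8`; hence `Ш[2^∞] = 0`
  obtain ⟨hrank, -⟩ := hGZK (congruentNumberCurve n) (le_of_eq hr1)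
  rw [hr1] at hrank
  have hs : monskySelmerRankOdd p = 1 :=
    monskySelmerRankOdd_eq_of_table p L d2 dm2 hL h2 hm2 (s := 1) (by rw [hker, pow_one])
  have hsel : Nat.card ((congruentNumberCurve n).selmerGroup 2) = 8 := by
    subst hn
    rw [hM k p hp hodd hinj, hs]
    norm_num
  have hbot := primaryComponent_sha_two_eq_bot_of_card_selmerGroup_eq_eight hn0 hrank hsel
  refine ⟨hr1, hrank, hbot, ?_⟩
  rw [bsdp_two_iff_of_LDerivOverOmegaReg_of_sha_two_eq_bot_of_torsionOrder_eq_four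
    (congruentNumberCurve n) hGZK hr1 hx hbot ht, padicValRat_two_zpow_mul_sq hLodd,
    ← hn, twoExponent_prod_eq p hp hodd hinj]
  omega

/-- **DOOR D-CN-6 — `BSD(E_n, 2)` with the Tamagawa product displayed.** As in
`bsdp_two_congruentNumberCurve_iff_of_genus`, plus the DISPLAYED datum `∏c_ℓ(E_n) = c = 2^{2k+1}`
(`htam`, `hc`; GAP G-T1, census / Tate's algorithm: `c₂ = 2`, `c_p = 4` at the `k` odd primes): then
`BSD(E_n, 2)`. [cite: TianYuanZhang2017, Thm. 1.2 and §1 (1.1)] [cite: Miller2011LMS, Def. 1.1 (arXiv:1010.2431 p. 3)] -/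
theorem bsdp_two_congruentNumberCurve_of_genus (h12 : thm12_parity_of_scriptL)
    (hGZK : rank_eq_analyticRank_of_analyticRank_le_one) (hM : monsky_card_selmerGroup_two_odd)
    (hp : ∀ i, (p i).Prime) (hodd : ∀ i, Odd (p i)) (hinj : Function.Injective p)
    {n : ℕ} (hn : ∏ i, p i = n) (h8 : n % 8 = 5 ∨ n % 8 = 7)
    (L : Fin k → Fin k → ZMod 2) (d2 dm2 : Fin k → ZMod 2)
    (hL : ∀ i j, addLegendreSym (p j) (p i) = L i j) (h2 : ∀ i, addLegendreSym 2 (p i) = d2 i)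
    (hm2 : ∀ i, addLegendreSym (-2) (p i) = dm2 i)
    (hker : Fintype.card {v : Fin k ⊕ Fin k → ZMod 2 // Matrix.fromBlocks
        (Matrix.of (fun i j => if i = j then ∑ l ∈ Finset.univ.erase i, L i l else L i j) +
          Matrix.diagonal d2) (Matrix.diagonal d2) (Matrix.diagonal d2)
        (Matrix.of (fun i j => if i = j then ∑ l ∈ Finset.univ.erase i, L i l else L i j) +
          Matrix.diagonal dm2) *ᵥ v = 0} = 2)
    (hρ : (rhoSubgroup n).index = 1)
    (hgen : Odd (genusSum₁ n fun d => genusClassNumber (GenusField d)) ∨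
      Odd (genusSum₂ n fun d => genusClassNumber (GenusField d)))
    (ht : haveI := isElliptic_congruentNumberCurve (hn ▸ (squarefree_prod_of_injective p hp hinj).ne_zero);
      (congruentNumberCurve n).torsionOrder = 4)
    {c : ℕ} (htam : haveI := isElliptic_congruentNumberCurve (hn ▸ (squarefree_prod_of_injective p hp hinj).ne_zero);
      (congruentNumberCurve n).tamagawaProduct = c) (hc : c = 2 ^ (2 * k + 1)) :
    haveI := isElliptic_congruentNumberCurve (hn ▸ (squarefree_prod_of_injective p hp hinj).ne_zero)
    BSDp (congruentNumberCurve n) 2 := by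
  haveI : Fact (Nat.Prime 2) := ⟨Nat.prime_two⟩
  refine (bsdp_two_congruentNumberCurve_iff_of_genus p h12 hGZK hM hp hodd hinj hn h8 L d2 dm2
    hL h2 hm2 hker hρ hgen ht).2.2.2.mpr ?_
  rw [htam, hc, padicValNat.prime_pow]

end Door


/-! ## §3 RE-KEY (APPEND-ONLY, p2-typer GEN 4, ruling T-81 / T-84): the door keyed to Thm 1.2 AS PRINTED

The GEN-1 fact `thm12_parity_of_scriptL` is MIS-STATED in its `Σ₂` clause (ERRATUM F-Σ2 in
`TianYuanZhang2017/GenusPeriodsParity.lean`: the printed second sum `genusSum₂'` includes the `ℓ = 0`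
term `{n}`); lit-1's repair is the fact `thm12_parity_of_scriptL'` and the twin
`rankOneDatum_of_index_eq_one'`.  The §2 theorems above are KEPT (referenced) but are conditional on
the mis-stated hypothesis and should no longer be consumed; the twin below is keyed to the printed
theorem, with the genus hypothesis `Σ₁` odd or `Σ₂'` odd.  The displayed-Tamagawa form
`bsdp_two_congruentNumberCurve_of_genus` is superseded by the nothing-displayed door and gets no twin
here (its re-keyed closed form is `bsdp_two_congruentNumberCurve_of_genus''` in
`P2/CongruentNumberPairsAtTwoPrimeSevenModEight.lean`). -/

section DoorPrinted

variable {k : ℕ} (p : Fin k → ℕ)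

/-- **DOOR D-CN-6 KEYED TO TYZ Thm 1.2 AS PRINTED — the biconditional** (twin of
`bsdp_two_congruentNumberCurve_iff_of_genus` with `h12 : thm12_parity_of_scriptL'` and the genus
hypothesis `Σ₁` odd or `Σ₂'` odd): `n = p₁⋯p_k` (distinct odd primes), `n ≡ 5, 7 (mod 8)`, `s(n) = 1`
by the table route (`hker`), `ρ(n) = 0` (`hρ`), `#E_n(ℚ)_tor = 4` (`ht`) ⟹ `ord_{s=1} L(E_n,s) = 1`,
rank `1`, `Ш(E_n)[2^∞] = 0`, and `BSD(E_n, 2) ⟺ ord₂ ∏c_ℓ(E_n) = 2k + 1`.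
[cite: TianYuanZhang2017, Thm. 1.2 and §1 (1.1); proof of Prop. 3.4 (p0016 L146)]
[cite: HeathBrown1994SelmerCongruentII, Appendix (Monsky), typescript p. 39 L10–L33]
[cite: Miller2011LMS, Def. 1.1 (arXiv:1010.2431 p. 3)] -/
theorem bsdp_two_congruentNumberCurve_iff_of_genus' (h12 : thm12_parity_of_scriptL')
    (hGZK : rank_eq_analyticRank_of_analyticRank_le_one) (hM : monsky_card_selmerGroup_two_odd)
    (hp : ∀ i, (p i).Prime) (hodd : ∀ i, Odd (p i)) (hinj : Function.Injective p)
    {n : ℕ} (hn : ∏ i, p i = n) (h8 : n % 8 = 5 ∨ n % 8 = 7)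
    (L : Fin k → Fin k → ZMod 2) (d2 dm2 : Fin k → ZMod 2)
    (hL : ∀ i j, addLegendreSym (p j) (p i) = L i j) (h2 : ∀ i, addLegendreSym 2 (p i) = d2 i)
    (hm2 : ∀ i, addLegendreSym (-2) (p i) = dm2 i)
    (hker : Fintype.card {v : Fin k ⊕ Fin k → ZMod 2 // Matrix.fromBlocks
        (Matrix.of (fun i j => if i = j then ∑ l ∈ Finset.univ.erase i, L i l else L i j) +
          Matrix.diagonal d2) (Matrix.diagonal d2) (Matrix.diagonal d2)
        (Matrix.of (fun i j => if i = j then ∑ l ∈ Finset.univ.erase i, L i l else L i j) +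
          Matrix.diagonal dm2) *ᵥ v = 0} = 2)
    (hρ : (rhoSubgroup n).index = 1)
    (hgen : Odd (genusSum₁ n fun d => genusClassNumber (GenusField d)) ∨
      Odd (genusSum₂' n fun d => genusClassNumber (GenusField d)))
    (ht : haveI := isElliptic_congruentNumberCurve (hn ▸ (squarefree_prod_of_injective p hp hinj).ne_zero);
      (congruentNumberCurve n).torsionOrder = 4) :
    haveI := isElliptic_congruentNumberCurve (hn ▸ (squarefree_prod_of_injective p hp hinj).ne_zero)
    (congruentNumberCurve n).analyticRank = 1 ∧ (congruentNumberCurve n).mordellWeilRank = 1 ∧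
      AddCommGroup.primaryComponent (congruentNumberCurve n).sha 2 = ⊥ ∧
      (BSDp (congruentNumberCurve n) 2 ↔
        padicValNat 2 (congruentNumberCurve n).tamagawaProduct = 2 * k + 1) := by
  have hsq : Squarefree n := hn ▸ squarefree_prod_of_injective p hp hinj
  have hn0 : n ≠ 0 := hsq.ne_zero
  haveI := isElliptic_congruentNumberCurve hn0
  haveI : Fact (Nat.Prime 2) := ⟨Nat.prime_two⟩
  -- TYZ (as printed): `ord = 1`, `L′ = 2^e · 𝓛² · Ω · Reg` with `𝓛` odd
  obtain ⟨Lz, hLodd, hr1, hderiv⟩ :=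
    rankOneDatum_of_index_eq_one' h12 hsq h8 hρ GenusField (isGenusFieldFamily_genusField n) hgen
  have hx : deriv (congruentNumberCurve n).entireLFunction 1 =
      (((2 : ℚ) ^ twoExponent n * (Lz : ℚ) ^ 2 : ℚ) : ℂ) *
        ((congruentNumberCurve n).realPeriodRat : ℂ) * ((congruentNumberCurve n).regulator : ℂ) := by
    rw [hderiv]; push_cast; ring
  -- GZK: rank `1`; Monsky + counted kernel: `#Sel₂ = 8`; hence `Ш[2^∞] = 0`
  obtain ⟨hrank, -⟩ := hGZK (congruentNumberCurve n) (le_of_eq hr1)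
  rw [hr1] at hrank
  have hs : monskySelmerRankOdd p = 1 :=
    monskySelmerRankOdd_eq_of_table p L d2 dm2 hL h2 hm2 (s := 1) (by rw [hker, pow_one])
  have hsel : Nat.card ((congruentNumberCurve n).selmerGroup 2) = 8 := by
    subst hn
    rw [hM k p hp hodd hinj, hs]
    norm_num
  have hbot := primaryComponent_sha_two_eq_bot_of_card_selmerGroup_eq_eight hn0 hrank hsel
  refine ⟨hr1, hrank, hbot, ?_⟩
  rw [bsdp_two_iff_of_LDerivOverOmegaReg_of_sha_two_eq_bot_of_torsionOrder_eq_four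
    (congruentNumberCurve n) hGZK hr1 hx hbot ht, padicValRat_two_zpow_mul_sq hLodd,
    ← hn, twoExponent_prod_eq p hp hodd hinj]
  omega

end DoorPrinted

end Summit.BirchSwinnertonDyer.Rank1Residual.P2

end
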